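import Summits.AtomisticToContinuum.Crystallization.Theorems.FrustratedLawDichotomyStrainedPatchHomEntryFitHcpSharpEta
import Summits.AtomisticToContinuum.Crystallization.Theorems.FrustratedLawDichotomyStrainedPatchHomEntryLeafHT4
import Summits.AtomisticToContinuum.Crystallization.Theorems.FrustratedLawDichotomyStrainedPatchHomEntryFitToleranceB

/-!
# The `η' = 4999/100000` fit verdict INSIDE the slab leaf: quick verdict `entryLeafOKHQE`, slab leaf `entryLeafOKHT4QE`, booking, and the kernel gain at the crossover
# (27623 `(H) HomFloor (1/625)`, hcp half; critic row 1147 (c), budget gate branch 3 «the HT4 socket takes any inner verdict with a one-line soundness change»)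

decomp-a2c hand-1 g30 (crux `AperiodicFrustratedLawGap`, stmt-AtomisticToContinuum-27623; sequel of `…HomEntryFitHcpSharpEta`).

* §1 `entryLeafOKHQE μ c w := fitOKHSE (symH c) (symH w) ∨ entryLeafOKHQ μ c w` and ★ `entryLeafOKHQE_sound` in the hver shape of
  `…HomEntryLeafHT4.entryLeafOKHT4_sound`'s `hinner` (symmetrised box via `…HomEntrySymBox.hbox_symU`; the quick verdict through `entryLeafOKHQ_imp` +
  `entryLeafOKHVK_sound`);
* §2 ★ `entryLeafOKHT4QE μ p t` (= `entryLeafOKHT4 (entryLeafOKHQE μ) p t`) + `_sound`; `entryLeafOKHT4QEX μ P T` (payload functions, ∨ the union verdict of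
  record `entryLeafOKHCCX μ`) + `_sound`; ★★ `hcpHalf_of_entryTreeHT4QEX`; ★★★ `homFloor_625_of_entryTrees6RBKP_HT4QEX` — VERBATIM the §3 of `…HomEntryLeafHT4`
  with the sharper inner verdict;
* §3 KERNEL GAIN at the worst-ray crossover (cells of `…HomEntryFitToleranceA/B`): `fitOKHSE` fires at `0.94 t_b` and `0.95 t_b` on `2⁻¹³ × 2⁻¹³` cells where
  `fitOKHS` does not (`…HomEntryFitToleranceB.fitS_T094_U13_X13` / `fitS_T095_U13_X13 … = false`): the crossover cell of the worst ray moves from `2⁻¹⁴`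
  to `2⁻¹³` (entries and shuffle), i.e. `2⁹ = 512×` fewer inner leaves per crossover cell of the 9-coordinate box, for one changed constant.

Definitions by composition only; 0 sorry; standard axioms (the two kernel facts: `decide +kernel`); no instances / notation / `#eval`.  `--supports stmt-AtomisticToContinuum-27623`.
-/

noncomputable section

namespace Summit.AtomisticToContinuum.Crystallization.Theorems.FrustratedLawDichotomyStrainedPatchHomEntryFitHcpSharpEta

open scoped BigOperators RealInnerProductSpace
open Literature.Analysis.ValidatedNumerics.Numerics
open Summit.AtomisticToContinuum.Crystallization.Theorems.ChargedEnergyGapNegative (E3)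
open Summit.AtomisticToContinuum.Crystallization.Theorems.FrustratedLawDichotomySchurCut (effPot w₄₅ ω₄)
open Summit.AtomisticToContinuum.Crystallization.Theorems.FrustratedLawDichotomyAveragingRuleTightFree (TightNearCap BadNearCap)
open Summit.AtomisticToContinuum.Crystallization.Theorems.FrustratedLawDichotomyExemptAbsorption (ExemptNear)
open Summit.AtomisticToContinuum.Crystallization.Theorems.FrustratedLawDichotomyStrainedPatchHomSplit (ExRec latPt hexFrame hcpShift HomFloor)
open Summit.AtomisticToContinuum.Crystallization.Theorems.FrustratedLawDichotomyStrainedPatchHomPrunedPolar (homFloor_of_prunedBoxSums_selfAdjoint)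
open Summit.AtomisticToContinuum.Crystallization.Theorems.FrustratedLawDichotomyStrainedPatchHomCertTree (CertTree treeOK)
open Summit.AtomisticToContinuum.Crystallization.Theorems.FrustratedLawDichotomyStrainedPatchHomEntryGram (rootC rootW)
open Summit.AtomisticToContinuum.Crystallization.Theorems.FrustratedLawDichotomyStrainedPatchHomEntryGramHcp (rootCH rootWH)
open Summit.AtomisticToContinuum.Crystallization.Theorems.FrustratedLawDichotomyStrainedPatchHomEntryTable (muRec muRec_ok)
open Summit.AtomisticToContinuum.Crystallization.Theorems.FrustratedLawDichotomyStrainedPatchHomEntryTableP (entryLeafOK6RBKP)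
open Summit.AtomisticToContinuum.Crystallization.Theorems.FrustratedLawDichotomyStrainedPatchHomEntryTreeCert (fccHalf_of_entryTree6RBKP)
open Summit.AtomisticToContinuum.Crystallization.Theorems.FrustratedLawDichotomyStrainedPatchHomEntryFlipHcp (HcpDich hcpHalf_of_entryTreeShuf)
open Summit.AtomisticToContinuum.Crystallization.Theorems.FrustratedLawDichotomyStrainedPatchHomEntrySymBox (symH hbox_symU)
open Summit.AtomisticToContinuum.Crystallization.Theorems.FrustratedLawDichotomyStrainedPatchHomEntryQuickHcp (entryLeafOKHQ entryLeafOKHQ_imp)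
open Summit.AtomisticToContinuum.Crystallization.Theorems.FrustratedLawDichotomyStrainedPatchHomLeafTableCheckHcpV (entryLeafOKHVK_sound)
open Summit.AtomisticToContinuum.Crystallization.Theorems.FrustratedLawDichotomyStrainedPatchHomCurvLeafHCC (entryLeafOKHCCX entryLeafOKHCCX_sound)
open Summit.AtomisticToContinuum.Crystallization.Theorems.FrustratedLawDichotomyStrainedPatchHomEntryLeafHT
  (HTCert entryLeafOKHT4 entryLeafOKHT4_sound)
open Summit.AtomisticToContinuum.Crystallization.Theorems.FrustratedLawDichotomyStrainedPatchHomEntryFitTolerance (cT094 cT095 wU13X13)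

/-! ## §1. The quick verdict with the `η' = 4999/100000` fit in front -/

/-- ★ **hcp QUICK VERDICT, SHARPER FIT FIRST**: `fitOKHSE` on the symmetrised box, else the quick verdict of record `entryLeafOKHQ μ`. -/
def entryLeafOKHQE (μ : ℤ) (c w : (Fin 3 × Fin 3) ⊕ Fin 3 → ℤ) : Bool :=
  fitOKHSE (symH c) (symH w) || entryLeafOKHQ μ c w

/-- ★ **Soundness of `entryLeafOKHQE` in the hver shape** (exactly the `hinner` hypothesis of `…HomEntryLeafHT4.entryLeafOKHT4_sound`). [folklore chaining:
`fitOKHSE_sound` on the symmetrised box (`hbox_symU`), else `entryLeafOKHQ_imp` + `entryLeafOKHVK_sound`] -/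
theorem entryLeafOKHQE_sound {μ : ℤ} (c w : (Fin 3 × Fin 3) ⊕ Fin 3 → ℤ) (h : entryLeafOKHQE μ c w = true) (U : E3 →L[ℝ] E3) (ξ : E3)
    (hsa : ∀ v v' : E3, ⟪U v, v'⟫ = ⟪v, U v'⟫) (hU : ‖U - 1‖ ≤ 1 / 4)
    (hbox : ∀ ab : Fin 3 × Fin 3, |(U (EuclideanSpace.single ab.2 (1 : ℝ))) ab.1 - (c (Sum.inl ab) : ℝ) / SC| ≤ (w (Sum.inl ab) : ℝ) / SC)
    (hξ : ∀ i : Fin 3, |ξ i - (c (Sum.inr i) : ℝ) / SC| ≤ (w (Sum.inr i) : ℝ) / SC) (h0 : 0 ≤ ξ 0) (h2 : 0 ≤ ξ 2) :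
    (∀ (M : ℕ) (z : Fin M → E3) (cc : Fin M), Function.Injective z →
        Set.range z = {x : E3 | dist x (z cc) ≤ 133 / 10 ∧ ∃ a : Fin 3 → ℤ,
          x = z cc + latPt U hexFrame a ∨ x = z cc + latPt U hexFrame a + U (hcpShift + ξ)} →
        TightNearCap (9 / 5) (3 / 2) z cc ∨ ExemptNear (9 / 5) ExRec z cc ∨ BadNearCap (9 / 5) (3 / 2) z cc) ∨
      (μ : ℝ) / SC ≤ ∑ b ∈ (Fintype.piFinset fun _ : Fin 3 => Finset.Icc (-7 : ℤ) 7).filter (fun b => b ≠ 0), effPot w₄₅ ω₄ (3 / 400) ‖latPt U hexFrame b‖ +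
        ∑ b ∈ (Fintype.piFinset fun _ : Fin 3 => Finset.Icc (-7 : ℤ) 7), effPot w₄₅ ω₄ (3 / 400) ‖latPt U hexFrame b + U (hcpShift + ξ)‖ := by
  simp only [entryLeafOKHQE, Bool.or_eq_true] at h
  rcases h with h | h
  · exact Or.inl (fitOKHSE_sound h U ξ hU (hbox_symU hsa hbox) hξ)
  · exact entryLeafOKHVK_sound (entryLeafOKHQ_imp μ c w h) U ξ hsa hU hbox hξ h0 h2

/-! ## §2. The slab leaf with the sharper inner verdict, and the booking -/

/-- ★ The analytic-slab leaf with inner sub-tree verdict `entryLeafOKHQE μ`. -/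
def entryLeafOKHT4QE (μ : ℤ) (p : HTCert) (t : CertTree ((Fin 3 × Fin 3) ⊕ Fin 3)) (c w : (Fin 3 × Fin 3) ⊕ Fin 3 → ℤ) : Bool :=
  entryLeafOKHT4 (entryLeafOKHQE μ) p t c w

/-- ★★ Soundness of `entryLeafOKHT4QE` in the hver shape. [folklore chaining: `entryLeafOKHT4_sound` with `entryLeafOKHQE_sound`] -/
theorem entryLeafOKHT4QE_sound {μ : ℤ} {p : HTCert} {t : CertTree ((Fin 3 × Fin 3) ⊕ Fin 3)} {c w : (Fin 3 × Fin 3) ⊕ Fin 3 → ℤ}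
    (h : entryLeafOKHT4QE μ p t c w = true) (U : E3 →L[ℝ] E3) (ξ : E3)
    (hsa : ∀ v v' : E3, ⟪U v, v'⟫ = ⟪v, U v'⟫) (hU : ‖U - 1‖ ≤ 1 / 4)
    (hbox : ∀ ab : Fin 3 × Fin 3, |(U (EuclideanSpace.single ab.2 (1 : ℝ))) ab.1 - (c (Sum.inl ab) : ℝ) / SC| ≤ (w (Sum.inl ab) : ℝ) / SC)
    (hξ : ∀ i : Fin 3, |ξ i - (c (Sum.inr i) : ℝ) / SC| ≤ (w (Sum.inr i) : ℝ) / SC) (h0 : 0 ≤ ξ 0) (h2 : 0 ≤ ξ 2) :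
    (∀ (M : ℕ) (z : Fin M → E3) (cc : Fin M), Function.Injective z →
        Set.range z = {x : E3 | dist x (z cc) ≤ 133 / 10 ∧ ∃ a : Fin 3 → ℤ,
          x = z cc + latPt U hexFrame a ∨ x = z cc + latPt U hexFrame a + U (hcpShift + ξ)} →
        TightNearCap (9 / 5) (3 / 2) z cc ∨ ExemptNear (9 / 5) ExRec z cc ∨ BadNearCap (9 / 5) (3 / 2) z cc) ∨
      (μ : ℝ) / SC ≤ ∑ b ∈ (Fintype.piFinset fun _ : Fin 3 => Finset.Icc (-7 : ℤ) 7).filter (fun b => b ≠ 0), effPot w₄₅ ω₄ (3 / 400) ‖latPt U hexFrame b‖ +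
        ∑ b ∈ (Fintype.piFinset fun _ : Fin 3 => Finset.Icc (-7 : ℤ) 7), effPot w₄₅ ω₄ (3 / 400) ‖latPt U hexFrame b + U (hcpShift + ξ)‖ :=
  entryLeafOKHT4_sound (fun c' w' hv V η hVsa hV1 hVb hη h0' h2' => entryLeafOKHQE_sound c' w' hv V η hVsa hV1 hVb hη h0' h2') h U ξ hsa hU hbox hξ h0 h2

/-- ★ The union verdict with payload FUNCTIONS (certificate `P c w`, inner sub-tree `T c w`), else the union verdict of record `entryLeafOKHCCX μ`. -/
def entryLeafOKHT4QEX (μ : ℤ) (P : ((Fin 3 × Fin 3) ⊕ Fin 3 → ℤ) → ((Fin 3 × Fin 3) ⊕ Fin 3 → ℤ) → HTCert)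
    (T : ((Fin 3 × Fin 3) ⊕ Fin 3 → ℤ) → ((Fin 3 × Fin 3) ⊕ Fin 3 → ℤ) → CertTree ((Fin 3 × Fin 3) ⊕ Fin 3))
    (c w : (Fin 3 × Fin 3) ⊕ Fin 3 → ℤ) : Bool :=
  entryLeafOKHT4QE μ (P c w) (T c w) c w || entryLeafOKHCCX μ c w

/-- ★★ Soundness of `entryLeafOKHT4QEX` in the hver shape. [folklore chaining] -/
theorem entryLeafOKHT4QEX_sound {μ : ℤ} {P : ((Fin 3 × Fin 3) ⊕ Fin 3 → ℤ) → ((Fin 3 × Fin 3) ⊕ Fin 3 → ℤ) → HTCert}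
    {T : ((Fin 3 × Fin 3) ⊕ Fin 3 → ℤ) → ((Fin 3 × Fin 3) ⊕ Fin 3 → ℤ) → CertTree ((Fin 3 × Fin 3) ⊕ Fin 3)}
    {c w : (Fin 3 × Fin 3) ⊕ Fin 3 → ℤ} (h : entryLeafOKHT4QEX μ P T c w = true) (U : E3 →L[ℝ] E3) (ξ : E3)
    (hsa : ∀ v v' : E3, ⟪U v, v'⟫ = ⟪v, U v'⟫) (hU : ‖U - 1‖ ≤ 1 / 4)
    (hbox : ∀ ab : Fin 3 × Fin 3, |(U (EuclideanSpace.single ab.2 (1 : ℝ))) ab.1 - (c (Sum.inl ab) : ℝ) / SC| ≤ (w (Sum.inl ab) : ℝ) / SC)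
    (hξ : ∀ i : Fin 3, |ξ i - (c (Sum.inr i) : ℝ) / SC| ≤ (w (Sum.inr i) : ℝ) / SC) (h0 : 0 ≤ ξ 0) (h2 : 0 ≤ ξ 2) :
    (∀ (M : ℕ) (z : Fin M → E3) (cc : Fin M), Function.Injective z →
        Set.range z = {x : E3 | dist x (z cc) ≤ 133 / 10 ∧ ∃ a : Fin 3 → ℤ,
          x = z cc + latPt U hexFrame a ∨ x = z cc + latPt U hexFrame a + U (hcpShift + ξ)} →
        TightNearCap (9 / 5) (3 / 2) z cc ∨ ExemptNear (9 / 5) ExRec z cc ∨ BadNearCap (9 / 5) (3 / 2) z cc) ∨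
      (μ : ℝ) / SC ≤ ∑ b ∈ (Fintype.piFinset fun _ : Fin 3 => Finset.Icc (-7 : ℤ) 7).filter (fun b => b ≠ 0), effPot w₄₅ ω₄ (3 / 400) ‖latPt U hexFrame b‖ +
        ∑ b ∈ (Fintype.piFinset fun _ : Fin 3 => Finset.Icc (-7 : ℤ) 7), effPot w₄₅ ω₄ (3 / 400) ‖latPt U hexFrame b + U (hcpShift + ξ)‖ := by
  simp only [entryLeafOKHT4QEX, Bool.or_eq_true] at h
  rcases h with h | h
  · exact entryLeafOKHT4QE_sound h U ξ hsa hU hbox hξ h0 h2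
  · exact entryLeafOKHCCX_sound h U ξ hsa hU hbox hξ h0 h2

/-- ★★ The hcp half from ONE certificate tree over `entryLeafOKHT4QEX μ P T`. [folklore chaining] -/
theorem hcpHalf_of_entryTreeHT4QEX {m : ℝ} {μ : ℤ} (hμ : 2 * (m + (-(7175 / 10000) + 3 / 400)) * SC ≤ μ)
    (P : ((Fin 3 × Fin 3) ⊕ Fin 3 → ℤ) → ((Fin 3 × Fin 3) ⊕ Fin 3 → ℤ) → HTCert)
    (T : ((Fin 3 × Fin 3) ⊕ Fin 3 → ℤ) → ((Fin 3 × Fin 3) ⊕ Fin 3 → ℤ) → CertTree ((Fin 3 × Fin 3) ⊕ Fin 3))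
    {t : CertTree ((Fin 3 × Fin 3) ⊕ Fin 3)} (h : treeOK (entryLeafOKHT4QEX μ P T) t rootCH rootWH = true) :
    ∀ (U : E3 →L[ℝ] E3) (ξ : E3), (∀ v w : E3, inner ℝ (U v) w = inner ℝ v (U w)) → (∀ w : E3, 0 ≤ inner ℝ w (U w)) →
      ‖U - 1‖ ≤ 1 / 4 → ‖ξ‖ ≤ 1 / 4 → HcpDich m U ξ :=
  hcpHalf_of_entryTreeShuf hμ (entryLeafOKHT4QEX μ P T) (fun _ _ hv U ξ hsa hU hbox hξ h0 h2 => entryLeafOKHT4QEX_sound hv U ξ hsa hU hbox hξ h0 h2) h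

/-- ★★★ **`(H) HomFloor (1/625)` OVER THE SLAB LEAF WITH THE `η' = 4999/100000` INNER FIT** (`μ = muRec`; any payload functions `P`, `T`). [folklore] -/
theorem homFloor_625_of_entryTrees6RBKP_HT4QEX (P : ((Fin 3 × Fin 3) ⊕ Fin 3 → ℤ) → ((Fin 3 × Fin 3) ⊕ Fin 3 → ℤ) → HTCert)
    (T : ((Fin 3 × Fin 3) ⊕ Fin 3 → ℤ) → ((Fin 3 × Fin 3) ⊕ Fin 3 → ℤ) → CertTree ((Fin 3 × Fin 3) ⊕ Fin 3))
    (hF : ∃ t : CertTree (Fin 3 × Fin 3), treeOK (entryLeafOK6RBKP muRec) t rootC rootW = true)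
    (hH : ∃ t : CertTree ((Fin 3 × Fin 3) ⊕ Fin 3), treeOK (entryLeafOKHT4QEX muRec P T) t rootCH rootWH = true) : HomFloor (1 / 625) := by
  obtain ⟨tF, htF⟩ := hF
  obtain ⟨tH, htH⟩ := hH
  exact homFloor_of_prunedBoxSums_selfAdjoint (fccHalf_of_entryTree6RBKP muRec_ok htF) (hcpHalf_of_entryTreeHT4QEX muRec_ok P T htH)

/-! ## §3. Kernel: the gain at the worst-ray crossover -/

/-- ★ KERNEL: at `0.94 t_b` the `η' = 4999/100000` fit FIRES on the `2⁻¹³ × 2⁻¹³` cell (`fitOKHS`: `…HomEntryFitToleranceB.fitS_T094_U13_X13 = false`). -/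
theorem fitSE_T094_U13_X13 : fitOKHSE (symH cT094) (symH wU13X13) = true := by
  decide +kernel

/-- ★ KERNEL: at `0.95 t_b` the `η' = 4999/100000` fit FIRES on the `2⁻¹³ × 2⁻¹³` cell (`fitOKHS`: `…HomEntryFitToleranceB.fitS_T095_U13_X13 = false`),
where also the energy tables of the quick verdict fire (`quick_T095_U13_X13`): at `2⁻¹³` the T and E sides now OVERLAP on the worst ray. -/
theorem fitSE_T095_U13_X13 : fitOKHSE (symH cT095) (symH wU13X13) = true := by
  decide +kernel

end Summit.AtomisticToContinuum.Crystallization.Theorems.FrustratedLawDichotomyStrainedPatchHomEntryFitHcpSharpEta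

end
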